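import Summits.BirchSwinnertonDyer.BirchSwinnertonDyer.Theorems.QuadraticBranchSignedControlNoFiniteSubmoduleOfStrictLayersInjective
import Summits.BirchSwinnertonDyer.Rank1Residual.Additive.StrictSignedSelmerInftyLocal
import HarnessLib

/-!
# The transitions `Sel^{ε,str}(W/K_n) → Sel^{ε,str}(W/K_{n+1})` of the Hachimori–Matsuno package
# DISCHARGED (restriction `resOfLe` preserves the strict signed Selmer condition: x1b's
# `strictSignedLocalPointsOfEmb_mono` + `resOfLe_mem_localKummerOverOfEmb`), the pinned data shown
# to EXIST, and the K8 nodes from the package reduced to its genuine inputs: corestriction with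
# adjointness, divisible parts, Cassels–Tate-type pairings (cell `bsd-potss`, seat `bsd-potss-k8q-c5`
# g3; route `QuadraticBranchSignedControl`, items stmt-BirchSwinnertonDyer-19117 / 19222 / 19233)

HONEST FRAMING (cell `bsd-potss`, run/shared/lean/pub/bsd-potss/): THEOREMS ONLY; the node stays
CONDITIONAL (settled by citation); BSD is not proved by any of this; no label / mark / count moves.
Sequel of p452849 (exhaustion, `Γ`-action) and p453559 (injectivity = Kobayashi Lemma 9.1). Here:
(§1) `resOfLe` along `Gal(K̄/K_{n+1}) ≤ Gal(K̄/K_n)` carries `Sel^{ε,str}(W/K_n)` into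
`Sel^{ε,str}(W/K_{n+1})` (classical part: `resOfLe_mem_selmerGroupOver`; strict signed Kummer part at
every conjugate: `resOfLe_comp_conjH1_holds`, `resOfLe_mem_localKummerOverOfEmb`,
`localKummerOverOfEmb_mono` with `strictSignedLocalPointsOfEmb_mono`); (§2) the pinned data of the
package EXIST as additive maps (`r_n` = `layerToInfty`, `γL_n` = `conj_γ`, `ι_n` = `resOfLe`), and the
pinned transition satisfies `r_{n+1} ∘ ι_n = r_n` (`resOfLe_comp_holds`); (§3) the three K8 decls
from the package whose DISPLAYED content is now only: for every `t ∈ Sel^{ε,str}(K_{n+1})` a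
`t' ∈ Sel^{ε,str}(K_n)` with `r_n t' = Σ_{i<p} conj_γ^{pⁿ i} r_{n+1} t` (corestriction, res ∘ cores =
norm) adjoint to the transition under the pairings; subgroups `D_n` (`p`-divisible, `conj_γ`-stable,
images stationary from some `m` — the maximal divisible subgroups, stationarity ⟸ (vi)); and
`conj_γ`-invariant biadditive pairings on `Sel^{ε,str}(W/ℚ_n)` with right kernel exactly `D_n`
representing every character of the quotient — the generalised Cassels–Tate pairing (Flach 1990;
self-duality of the `±` condition B. D. Kim 2007 Prop. 3.18, read at `η`).

References: [HachimoriMatsuno2000] Theorem (p. 2540); [Kobayashi2003] Def. 2.1 (p. 5), Lemma 9.1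
(p. 25), proof of Prop. 8.12 (p. 18); [KitajimaOtsuki2018] Lemma 4.2, Thm. 4.5 (arXiv:1607.03612 p. 18);
[GreenbergLNM1716] §2 p. 71, §3 pp. 85–86.
-/

set_option autoImplicit false
-- `Summit.BirchSwinnertonDyer.BirchSwinnertonDyer.…` is the lane's mandated namespace (sub = summit).
set_option linter.dupNamespace false

noncomputable section

open scoped Classical

universe u

open WeierstrassCurve Field Literature.NumberTheory.EllipticCurves
  Literature.NumberTheory.EllipticCurves.Kobayashi2003
  Literature.NumberTheory.GaloisRepresentations ZpExtension
  Summit.BirchSwinnertonDyer.Rank1Residual Summit.BirchSwinnertonDyer.Rank1Residual.Additive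

namespace Summit.BirchSwinnertonDyer.BirchSwinnertonDyer.Theorems

open Summit.BirchSwinnertonDyer.BirchSwinnertonDyer.Theses.QuadraticBranchSignedControl

section Transition

variable {K : Type u} [Field K] [NumberField K] (W : WeierstrassCurve K) {p : ℕ} [Fact p.Prime]
  (κ : ZpExtension K p) (E : Type u) [Field E] [Algebra K E] (ε : ℤˣ)

/-! ## §1 Restriction carries `Sel^{ε,str}(W/K_n)` into `Sel^{ε,str}(W/K_{n+1})` -/

/-- **The transition of the strict signed Selmer groups**: restriction along
`Gal(K̄/K_{n+1}) ≤ Gal(K̄/K_n)` maps `Sel^{ε,str}(W/K_n)` into `Sel^{ε,str}(W/K_{n+1})` — the classical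
condition by `resOfLe_mem_selmerGroupOver`, the strict signed Kummer condition at every conjugate
because restriction commutes with conjugation (`resOfLe_comp_conjH1_holds`), preserves Kummer
conditions (`resOfLe_mem_localKummerOverOfEmb`) and `E^{ε,str}(K_n·E) ≤ E^{ε,str}(K_{n+1}·E)`
(`strictSignedLocalPointsOfEmb_mono`, `localKummerOverOfEmb_mono`).
[cite: Kobayashi2003, Def. 2.1 (p. 5), proof of Prop. 8.12 (p. 18)] [cite: GreenbergLNM1716, §2 p. 71] -/
theorem strictLayer_transition_mem (n : ℕ) {c : W.subgroupH1 p (κ.layerSubgroup n)}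
    (hc : c ∈ strictSignedSelmerLayer W κ E ε n) :
    W.resOfLe p (κ.layerSubgroup_antitone n.le_succ) c ∈ strictSignedSelmerLayer W κ E ε (n + 1) := by
  rw [mem_strictSignedSelmerLayer_iff] at hc ⊢
  refine ⟨W.resOfLe_mem_selmerGroupOver p (κ.layerSubgroup_antitone n.le_succ) hc.1, fun σ ↦ ?_⟩
  have hcomm : W.conjH1 p (κ.layerSubgroup (n + 1)) σ
      (W.resOfLe p (κ.layerSubgroup_antitone n.le_succ) c) =
      W.resOfLe p (κ.layerSubgroup_antitone n.le_succ) (W.conjH1 p (κ.layerSubgroup n) σ c) :=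
    (congrArg (fun f ↦ f c)
      (resOfLe_comp_conjH1_holds (M := geomPrimaryTorsion W p)
        (κ.layerSubgroup_antitone n.le_succ) σ)).symm
  rw [hcomm]
  exact localKummerOverOfEmb_mono
    (strictSignedLocalPointsOfEmb_mono κ (closureEmb (K := K) E) W ε n.le_succ)
    (resOfLe_mem_localKummerOverOfEmb W p (closureEmb (K := K) E)
      (κ.layerSubgroup_antitone n.le_succ) (strictSignedLocalPoints κ E W ε n) (hc.2 σ))

/-! ## §2 The pinned data of the package exist; the pinned transition is a transition -/

/-- **The restrictions `r_n : Sel^{ε,str}(W/K_n) → Sel^{ε,str}(W/K_∞)` exist as additive maps pinned to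
`layerToInfty`** (`map_layerToInfty_strictSignedSelmerLayer_le`). [cite: Kobayashi2003, Def. 2.1 (p. 5)] -/
theorem exists_strictLayer_r :
    ∃ r : ∀ n, strictSignedSelmerLayer W κ E ε n →+ strictSignedSelmerInfty W κ E ε,
      ∀ n (x : strictSignedSelmerLayer W κ E ε n),
        ((r n x : strictSignedSelmerInfty W κ E ε) : W.subgroupH1 p κ.kerSubgroup) =
          W.layerToInfty κ n (x : W.subgroupH1 p (κ.layerSubgroup n)) :=
  ⟨fun n ↦ ((W.layerToInfty κ n).restrict (strictSignedSelmerLayer W κ E ε n)).codRestrict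
      (strictSignedSelmerInfty W κ E ε)
      fun x ↦ map_layerToInfty_strictSignedSelmerLayer_le W κ E ε n ⟨x, x.2, rfl⟩,
    fun _ _ ↦ rfl⟩

/-- **The layer actions `γL_n` exist as additive maps pinned to `conj_γ`**
(`conjH1_mem_strictSignedSelmerLayer`). [cite: GreenbergLNM1716, §1] -/
theorem exists_strictLayer_γL (γ : Field.absoluteGaloisGroup K) :
    ∃ γL : ∀ n, strictSignedSelmerLayer W κ E ε n →+ strictSignedSelmerLayer W κ E ε n,
      ∀ n (x : strictSignedSelmerLayer W κ E ε n),
        ((γL n x : strictSignedSelmerLayer W κ E ε n) : W.subgroupH1 p (κ.layerSubgroup n)) =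
          W.conjH1 p (κ.layerSubgroup n) γ (x : W.subgroupH1 p (κ.layerSubgroup n)) :=
  ⟨fun n ↦ ((W.conjH1 p (κ.layerSubgroup n) γ).restrict (strictSignedSelmerLayer W κ E ε n)).codRestrict
      (strictSignedSelmerLayer W κ E ε n)
      fun x ↦ conjH1_mem_strictSignedSelmerLayer W κ E ε n γ x.2,
    fun _ _ ↦ rfl⟩

/-- **The transitions `ι_n` exist as additive maps pinned to `resOfLe`** (§1).
[cite: Kobayashi2003, Def. 2.1 (p. 5)] -/
theorem exists_strictLayer_ι :
    ∃ ι : ∀ n, strictSignedSelmerLayer W κ E ε n →+ strictSignedSelmerLayer W κ E ε (n + 1),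
      ∀ n (x : strictSignedSelmerLayer W κ E ε n),
        ((ι n x : strictSignedSelmerLayer W κ E ε (n + 1)) : W.subgroupH1 p (κ.layerSubgroup (n + 1))) =
          W.resOfLe p (κ.layerSubgroup_antitone n.le_succ) (x : W.subgroupH1 p (κ.layerSubgroup n)) :=
  ⟨fun n ↦ ((W.resOfLe p (κ.layerSubgroup_antitone n.le_succ)).restrict
      (strictSignedSelmerLayer W κ E ε n)).codRestrict (strictSignedSelmerLayer W κ E ε (n + 1))
      fun x ↦ strictLayer_transition_mem W κ E ε n x.2,
    fun _ _ ↦ rfl⟩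

variable {W κ E ε}

/-- **A transition pinned to `resOfLe` IS a transition over `Sel_∞`**: `r_{n+1} (ι_n x) = r_n x`
(`resOfLe_comp_holds`: restriction `K_n → K_{n+1} → K_∞` is restriction `K_n → K_∞`).
[cite: GreenbergLNM1716, §3 p. 86 (the maps h_n)] -/
theorem strictLayer_r_transition
    (r : ∀ n, strictSignedSelmerLayer W κ E ε n →+ strictSignedSelmerInfty W κ E ε)
    (hr : ∀ n (x : strictSignedSelmerLayer W κ E ε n),
      ((r n x : strictSignedSelmerInfty W κ E ε) : W.subgroupH1 p κ.kerSubgroup) =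
        W.layerToInfty κ n (x : W.subgroupH1 p (κ.layerSubgroup n)))
    (ι : ∀ n, strictSignedSelmerLayer W κ E ε n →+ strictSignedSelmerLayer W κ E ε (n + 1))
    (hι : ∀ n (x : strictSignedSelmerLayer W κ E ε n),
      ((ι n x : strictSignedSelmerLayer W κ E ε (n + 1)) : W.subgroupH1 p (κ.layerSubgroup (n + 1))) =
        W.resOfLe p (κ.layerSubgroup_antitone n.le_succ) (x : W.subgroupH1 p (κ.layerSubgroup n)))
    (n : ℕ) (x : strictSignedSelmerLayer W κ E ε n) : r (n + 1) (ι n x) = r n x := by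
  apply Subtype.ext
  rw [hr, hι, hr]
  change ((W.resOfLe p (κ.kerSubgroup_le_layerSubgroup (n + 1))).comp
      (W.resOfLe p (κ.layerSubgroup_antitone n.le_succ))) (x : W.subgroupH1 p (κ.layerSubgroup n)) = _
  rw [W.resOfLe_comp_holds p]
  rfl

end Transition

/-! ## §3 The K8 nodes from the package reduced to its GENUINE inputs (cores + divisible parts + pairing) -/

/-- **(R2⁺) `NoFiniteSubmodulePlus` (item stmt-BirchSwinnertonDyer-19222) from the Hachimori–Matsuno
package on the tree's layers REDUCED TO ITS GENUINE INPUTS**: for the restriction maps `r_n`, the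
conjugation `γL_n = conj_γ` and the transition `ι_n = res` (universally quantified, pinned by their
values — they exist, §2), the consumer supplies ONLY: corestrictions realising the norm and adjoint to
`ι_n`, the divisible parts `D_n` (`p`-divisible, `conj_γ`-stable, images stationary from some `m`) and
`conj_γ`-invariant pairings with right kernel exactly `D_n` representing every character of
`Sel^{+,str}(W/ℚ_n)/D_n` — the generalised Cassels–Tate input. Injectivity (Kobayashi 9.1, p453559),
exhaustion and `Γ`-action (p452849) and the transition property (§2) are kernel theorems.
CONDITIONAL; closes nothing by itself. [cite: HachimoriMatsuno2000, Theorem and Corollary (i) (p. 2540)]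
[cite: Kobayashi2003, Def. 2.1, Thm. 2.2 (p. 5), Lemma 9.1 (p. 25)] -/
theorem noFiniteSubmodulePlus_of_casselsTateLayerInputs
    (h : ∀ (W : WeierstrassCurve ℚ) [W.IsElliptic] [W.IsGloballyMinimal] (p : ℕ) [Fact p.Prime]
        (V : WeierstrassCurve ℚ) [V.IsElliptic] [V.IsGloballyMinimal] (C : VariableChange ℚ),
      5 ≤ p → C • W.quadraticTwist ((-1) ^ (p / 2) * p) = V →
      V.HasGoodReductionAtPrime p → V.frobeniusTrace p = 0 →
      ∀ (κ : ZpExtension ℚ p) (γ : Field.absoluteGaloisGroup ℚ),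
        κ.IsCyclotomic → κ.IsTopGenerator γ →
      ∀ (D : StrictSignedSelmerDualData W κ ℚ_[p] γ 1),
        Module.Finite (IwasawaAlgebra p) D.X → Module.IsTorsion (IwasawaAlgebra p) D.X →
      ∀ (r : ∀ n, strictSignedSelmerLayer W κ ℚ_[p] 1 n →+ strictSignedSelmerInfty W κ ℚ_[p] 1),
        (∀ n (x : strictSignedSelmerLayer W κ ℚ_[p] 1 n),
          ((r n x : strictSignedSelmerInfty W κ ℚ_[p] 1) : W.subgroupH1 p κ.kerSubgroup) =
            W.layerToInfty κ n (x : W.subgroupH1 p (κ.layerSubgroup n))) →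
      ∀ (γL : ∀ n, strictSignedSelmerLayer W κ ℚ_[p] 1 n →+ strictSignedSelmerLayer W κ ℚ_[p] 1 n),
        (∀ n (x : strictSignedSelmerLayer W κ ℚ_[p] 1 n),
          ((γL n x : strictSignedSelmerLayer W κ ℚ_[p] 1 n) : W.subgroupH1 p (κ.layerSubgroup n)) =
            W.conjH1 p (κ.layerSubgroup n) γ (x : W.subgroupH1 p (κ.layerSubgroup n))) →
      ∀ (ι : ∀ n, strictSignedSelmerLayer W κ ℚ_[p] 1 n →+ strictSignedSelmerLayer W κ ℚ_[p] 1 (n + 1)),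
        (∀ n (x : strictSignedSelmerLayer W κ ℚ_[p] 1 n),
          ((ι n x : strictSignedSelmerLayer W κ ℚ_[p] 1 (n + 1)) : W.subgroupH1 p (κ.layerSubgroup (n + 1))) =
            W.resOfLe p (κ.layerSubgroup_antitone n.le_succ)
              (x : W.subgroupH1 p (κ.layerSubgroup n))) →
      ∃ (Dn : ∀ n, AddSubgroup (strictSignedSelmerLayer W κ ℚ_[p] 1 n))
        (pair : ∀ n, strictSignedSelmerLayer W κ ℚ_[p] 1 n →+ strictSignedSelmerLayer W κ ℚ_[p] 1 n →+ AddCircle (1 : ℚ)) (m : ℕ),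
      (∀ n (t : strictSignedSelmerLayer W κ ℚ_[p] 1 (n + 1)), ∃ t' : strictSignedSelmerLayer W κ ℚ_[p] 1 n,
        r n t' = ∑ i ∈ Finset.range p,
          ((conjStrictSignedSelmerInfty W κ ℚ_[p] 1 γ) ^ (p ^ n * i)) (r (n + 1) t) ∧
        ∀ y : strictSignedSelmerLayer W κ ℚ_[p] 1 n, pair n y t' = pair (n + 1) (ι n y) t) ∧
      (∀ n, ∀ d ∈ Dn n, ∃ d' ∈ Dn n, p • d' = d) ∧
      (∀ n, ∀ d ∈ Dn n, γL n d ∈ Dn n) ∧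
      (∀ n, m ≤ n → (Dn (n + 1)).map (r (n + 1)) ≤ (Dn n).map (r n)) ∧
      (∀ n (t : strictSignedSelmerLayer W κ ℚ_[p] 1 n),
        (∀ y : strictSignedSelmerLayer W κ ℚ_[p] 1 n, pair n y t = 0) → t ∈ Dn n) ∧
      (∀ n, ∀ t ∈ Dn n, ∀ y : strictSignedSelmerLayer W κ ℚ_[p] 1 n, pair n y t = 0) ∧
      (∀ n (g : strictSignedSelmerLayer W κ ℚ_[p] 1 n →+ AddCircle (1 : ℚ)), (∀ d ∈ Dn n, g d = 0) →
        ∃ c : strictSignedSelmerLayer W κ ℚ_[p] 1 n, ∀ y : strictSignedSelmerLayer W κ ℚ_[p] 1 n, g y = pair n y c) ∧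
      (∀ n (y t : strictSignedSelmerLayer W κ ℚ_[p] 1 n), pair n (γL n y) (γL n t) = pair n y t)) :
    NoFiniteSubmodulePlus := by
  intro W _ _ p _ hp5 V _ _ C hp2 hC hgood hap κ γ hκ hγ D hfin htor M hM
  obtain ⟨r, hr⟩ := exists_strictLayer_r W κ ℚ_[p] (1 : ℤˣ)
  obtain ⟨γL, hγL⟩ := exists_strictLayer_γL W κ ℚ_[p] (1 : ℤˣ) γ
  obtain ⟨ι, hι⟩ := exists_strictLayer_ι W κ ℚ_[p] (1 : ℤˣ)
  obtain ⟨Dn, pair, m, hcores, hDdiv, hDγ, hDst, hker, hD0, hsurj, hinv⟩ :=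
    h W p V C hp5 hC hgood hap κ γ hκ hγ D hfin htor r hr γL hγL ι hι
  exact StrictSignedSelmerDualData.forall_finite_eq_bot_of_strictLayerPackage D
    ⟨r, γL, ι, Dn, pair, m, hr, hγL,
      strictLayer_r_injective_of_fixedPoints_eq_bot hγ (fixedPoints_eq_bot_of_gss2 κ hp2 W C hC hgood hap)
        r hr,
      strictLayer_r_transition r hr ι hι, hcores, hDdiv, hDγ, hDst, hker, hD0, hsurj, hinv⟩ M hM

/-- **(R2⁻) `NoFiniteSubmoduleMinus` (item stmt-BirchSwinnertonDyer-19233), same reduction** (strict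
minus condition). CONDITIONAL; closes nothing by itself.
[cite: HachimoriMatsuno2000, Theorem and Corollary (i) (p. 2540)]
[cite: Kobayashi2003, Def. 2.1, §2 p. 4 (m = −1), Thm. 2.2 (p. 5), Lemma 9.1 (p. 25)] -/
theorem noFiniteSubmoduleMinus_of_casselsTateLayerInputs
    (h : ∀ (W : WeierstrassCurve ℚ) [W.IsElliptic] [W.IsGloballyMinimal] (p : ℕ) [Fact p.Prime]
        (V : WeierstrassCurve ℚ) [V.IsElliptic] [V.IsGloballyMinimal] (C : VariableChange ℚ),
      5 ≤ p → C • W.quadraticTwist ((-1) ^ (p / 2) * p) = V →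
      V.HasGoodReductionAtPrime p → V.frobeniusTrace p = 0 →
      ∀ (κ : ZpExtension ℚ p) (γ : Field.absoluteGaloisGroup ℚ),
        κ.IsCyclotomic → κ.IsTopGenerator γ →
      ∀ (D : StrictSignedSelmerDualData W κ ℚ_[p] γ (-1)),
        Module.Finite (IwasawaAlgebra p) D.X → Module.IsTorsion (IwasawaAlgebra p) D.X →
      ∀ (r : ∀ n, strictSignedSelmerLayer W κ ℚ_[p] (-1) n →+ strictSignedSelmerInfty W κ ℚ_[p] (-1)),
        (∀ n (x : strictSignedSelmerLayer W κ ℚ_[p] (-1) n),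
          ((r n x : strictSignedSelmerInfty W κ ℚ_[p] (-1)) : W.subgroupH1 p κ.kerSubgroup) =
            W.layerToInfty κ n (x : W.subgroupH1 p (κ.layerSubgroup n))) →
      ∀ (γL : ∀ n, strictSignedSelmerLayer W κ ℚ_[p] (-1) n →+ strictSignedSelmerLayer W κ ℚ_[p] (-1) n),
        (∀ n (x : strictSignedSelmerLayer W κ ℚ_[p] (-1) n),
          ((γL n x : strictSignedSelmerLayer W κ ℚ_[p] (-1) n) : W.subgroupH1 p (κ.layerSubgroup n)) =
            W.conjH1 p (κ.layerSubgroup n) γ (x : W.subgroupH1 p (κ.layerSubgroup n))) →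
      ∀ (ι : ∀ n, strictSignedSelmerLayer W κ ℚ_[p] (-1) n →+ strictSignedSelmerLayer W κ ℚ_[p] (-1) (n + 1)),
        (∀ n (x : strictSignedSelmerLayer W κ ℚ_[p] (-1) n),
          ((ι n x : strictSignedSelmerLayer W κ ℚ_[p] (-1) (n + 1)) : W.subgroupH1 p (κ.layerSubgroup (n + 1))) =
            W.resOfLe p (κ.layerSubgroup_antitone n.le_succ)
              (x : W.subgroupH1 p (κ.layerSubgroup n))) →
      ∃ (Dn : ∀ n, AddSubgroup (strictSignedSelmerLayer W κ ℚ_[p] (-1) n))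
        (pair : ∀ n, strictSignedSelmerLayer W κ ℚ_[p] (-1) n →+ strictSignedSelmerLayer W κ ℚ_[p] (-1) n →+ AddCircle (1 : ℚ)) (m : ℕ),
      (∀ n (t : strictSignedSelmerLayer W κ ℚ_[p] (-1) (n + 1)), ∃ t' : strictSignedSelmerLayer W κ ℚ_[p] (-1) n,
        r n t' = ∑ i ∈ Finset.range p,
          ((conjStrictSignedSelmerInfty W κ ℚ_[p] (-1) γ) ^ (p ^ n * i)) (r (n + 1) t) ∧
        ∀ y : strictSignedSelmerLayer W κ ℚ_[p] (-1) n, pair n y t' = pair (n + 1) (ι n y) t) ∧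
      (∀ n, ∀ d ∈ Dn n, ∃ d' ∈ Dn n, p • d' = d) ∧
      (∀ n, ∀ d ∈ Dn n, γL n d ∈ Dn n) ∧
      (∀ n, m ≤ n → (Dn (n + 1)).map (r (n + 1)) ≤ (Dn n).map (r n)) ∧
      (∀ n (t : strictSignedSelmerLayer W κ ℚ_[p] (-1) n),
        (∀ y : strictSignedSelmerLayer W κ ℚ_[p] (-1) n, pair n y t = 0) → t ∈ Dn n) ∧
      (∀ n, ∀ t ∈ Dn n, ∀ y : strictSignedSelmerLayer W κ ℚ_[p] (-1) n, pair n y t = 0) ∧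
      (∀ n (g : strictSignedSelmerLayer W κ ℚ_[p] (-1) n →+ AddCircle (1 : ℚ)), (∀ d ∈ Dn n, g d = 0) →
        ∃ c : strictSignedSelmerLayer W κ ℚ_[p] (-1) n, ∀ y : strictSignedSelmerLayer W κ ℚ_[p] (-1) n, g y = pair n y c) ∧
      (∀ n (y t : strictSignedSelmerLayer W κ ℚ_[p] (-1) n), pair n (γL n y) (γL n t) = pair n y t)) :
    NoFiniteSubmoduleMinus := by
  intro W _ _ p _ hp5 V _ _ C hp2 hC hgood hap κ γ hκ hγ D hfin htor M hM
  obtain ⟨r, hr⟩ := exists_strictLayer_r W κ ℚ_[p] ((-1) : ℤˣ)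
  obtain ⟨γL, hγL⟩ := exists_strictLayer_γL W κ ℚ_[p] ((-1) : ℤˣ) γ
  obtain ⟨ι, hι⟩ := exists_strictLayer_ι W κ ℚ_[p] ((-1) : ℤˣ)
  obtain ⟨Dn, pair, m, hcores, hDdiv, hDγ, hDst, hker, hD0, hsurj, hinv⟩ :=
    h W p V C hp5 hC hgood hap κ γ hκ hγ D hfin htor r hr γL hγL ι hι
  exact StrictSignedSelmerDualData.forall_finite_eq_bot_of_strictLayerPackage D
    ⟨r, γL, ι, Dn, pair, m, hr, hγL,
      strictLayer_r_injective_of_fixedPoints_eq_bot hγ (fixedPoints_eq_bot_of_gss2 κ hp2 W C hC hgood hap)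
        r hr,
      strictLayer_r_transition r hr ι hι, hcores, hDdiv, hDγ, hDst, hker, hD0, hsurj, hinv⟩ M hM

/-- **(R2±) the K8 node `NoFiniteSubmoduleSigned` (item stmt-BirchSwinnertonDyer-19117) from the
Cassels–Tate layer inputs of both signs** — the end of the Hachimori–Matsuno road on the tree's own
objects: what is displayed is exactly (per sign, per Gss2 datum) corestriction with res ∘ cores = norm
and res/cores adjointness, the stationary divisible parts, and the `conj_γ`-invariant non-degenerate
pairing on `Sel^{ε,str}(W/ℚ_n)/D_n` (in print: Flach 1990 for the self-dual `±` structure, self-duality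
B. D. Kim 2007 Prop. 3.18, read at `η`; adjointness locus to be confirmed by the typer).
CONDITIONAL; closes nothing by itself. [cite: HachimoriMatsuno2000, Theorem and Corollary (i) (p. 2540)]
[cite: KitajimaOtsuki2018, Main Thm. 1.3, Prop. 4.1, Lemma 4.2, Thm. 4.5 (arXiv:1607.03612 pp. 3, 18)] -/
theorem noFiniteSubmoduleSigned_of_casselsTateLayerInputs
    (hplus : ∀ (W : WeierstrassCurve ℚ) [W.IsElliptic] [W.IsGloballyMinimal] (p : ℕ) [Fact p.Prime]
        (V : WeierstrassCurve ℚ) [V.IsElliptic] [V.IsGloballyMinimal] (C : VariableChange ℚ),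
      5 ≤ p → C • W.quadraticTwist ((-1) ^ (p / 2) * p) = V →
      V.HasGoodReductionAtPrime p → V.frobeniusTrace p = 0 →
      ∀ (κ : ZpExtension ℚ p) (γ : Field.absoluteGaloisGroup ℚ),
        κ.IsCyclotomic → κ.IsTopGenerator γ →
      ∀ (D : StrictSignedSelmerDualData W κ ℚ_[p] γ 1),
        Module.Finite (IwasawaAlgebra p) D.X → Module.IsTorsion (IwasawaAlgebra p) D.X →
      ∀ (r : ∀ n, strictSignedSelmerLayer W κ ℚ_[p] 1 n →+ strictSignedSelmerInfty W κ ℚ_[p] 1),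
        (∀ n (x : strictSignedSelmerLayer W κ ℚ_[p] 1 n),
          ((r n x : strictSignedSelmerInfty W κ ℚ_[p] 1) : W.subgroupH1 p κ.kerSubgroup) =
            W.layerToInfty κ n (x : W.subgroupH1 p (κ.layerSubgroup n))) →
      ∀ (γL : ∀ n, strictSignedSelmerLayer W κ ℚ_[p] 1 n →+ strictSignedSelmerLayer W κ ℚ_[p] 1 n),
        (∀ n (x : strictSignedSelmerLayer W κ ℚ_[p] 1 n),
          ((γL n x : strictSignedSelmerLayer W κ ℚ_[p] 1 n) : W.subgroupH1 p (κ.layerSubgroup n)) =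
            W.conjH1 p (κ.layerSubgroup n) γ (x : W.subgroupH1 p (κ.layerSubgroup n))) →
      ∀ (ι : ∀ n, strictSignedSelmerLayer W κ ℚ_[p] 1 n →+ strictSignedSelmerLayer W κ ℚ_[p] 1 (n + 1)),
        (∀ n (x : strictSignedSelmerLayer W κ ℚ_[p] 1 n),
          ((ι n x : strictSignedSelmerLayer W κ ℚ_[p] 1 (n + 1)) : W.subgroupH1 p (κ.layerSubgroup (n + 1))) =
            W.resOfLe p (κ.layerSubgroup_antitone n.le_succ)
              (x : W.subgroupH1 p (κ.layerSubgroup n))) →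
      ∃ (Dn : ∀ n, AddSubgroup (strictSignedSelmerLayer W κ ℚ_[p] 1 n))
        (pair : ∀ n, strictSignedSelmerLayer W κ ℚ_[p] 1 n →+ strictSignedSelmerLayer W κ ℚ_[p] 1 n →+ AddCircle (1 : ℚ)) (m : ℕ),
      (∀ n (t : strictSignedSelmerLayer W κ ℚ_[p] 1 (n + 1)), ∃ t' : strictSignedSelmerLayer W κ ℚ_[p] 1 n,
        r n t' = ∑ i ∈ Finset.range p,
          ((conjStrictSignedSelmerInfty W κ ℚ_[p] 1 γ) ^ (p ^ n * i)) (r (n + 1) t) ∧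
        ∀ y : strictSignedSelmerLayer W κ ℚ_[p] 1 n, pair n y t' = pair (n + 1) (ι n y) t) ∧
      (∀ n, ∀ d ∈ Dn n, ∃ d' ∈ Dn n, p • d' = d) ∧
      (∀ n, ∀ d ∈ Dn n, γL n d ∈ Dn n) ∧
      (∀ n, m ≤ n → (Dn (n + 1)).map (r (n + 1)) ≤ (Dn n).map (r n)) ∧
      (∀ n (t : strictSignedSelmerLayer W κ ℚ_[p] 1 n),
        (∀ y : strictSignedSelmerLayer W κ ℚ_[p] 1 n, pair n y t = 0) → t ∈ Dn n) ∧
      (∀ n, ∀ t ∈ Dn n, ∀ y : strictSignedSelmerLayer W κ ℚ_[p] 1 n, pair n y t = 0) ∧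
      (∀ n (g : strictSignedSelmerLayer W κ ℚ_[p] 1 n →+ AddCircle (1 : ℚ)), (∀ d ∈ Dn n, g d = 0) →
        ∃ c : strictSignedSelmerLayer W κ ℚ_[p] 1 n, ∀ y : strictSignedSelmerLayer W κ ℚ_[p] 1 n, g y = pair n y c) ∧
      (∀ n (y t : strictSignedSelmerLayer W κ ℚ_[p] 1 n), pair n (γL n y) (γL n t) = pair n y t))
    (hminus : ∀ (W : WeierstrassCurve ℚ) [W.IsElliptic] [W.IsGloballyMinimal] (p : ℕ) [Fact p.Prime]
        (V : WeierstrassCurve ℚ) [V.IsElliptic] [V.IsGloballyMinimal] (C : VariableChange ℚ),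
      5 ≤ p → C • W.quadraticTwist ((-1) ^ (p / 2) * p) = V →
      V.HasGoodReductionAtPrime p → V.frobeniusTrace p = 0 →
      ∀ (κ : ZpExtension ℚ p) (γ : Field.absoluteGaloisGroup ℚ),
        κ.IsCyclotomic → κ.IsTopGenerator γ →
      ∀ (D : StrictSignedSelmerDualData W κ ℚ_[p] γ (-1)),
        Module.Finite (IwasawaAlgebra p) D.X → Module.IsTorsion (IwasawaAlgebra p) D.X →
      ∀ (r : ∀ n, strictSignedSelmerLayer W κ ℚ_[p] (-1) n →+ strictSignedSelmerInfty W κ ℚ_[p] (-1)),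
        (∀ n (x : strictSignedSelmerLayer W κ ℚ_[p] (-1) n),
          ((r n x : strictSignedSelmerInfty W κ ℚ_[p] (-1)) : W.subgroupH1 p κ.kerSubgroup) =
            W.layerToInfty κ n (x : W.subgroupH1 p (κ.layerSubgroup n))) →
      ∀ (γL : ∀ n, strictSignedSelmerLayer W κ ℚ_[p] (-1) n →+ strictSignedSelmerLayer W κ ℚ_[p] (-1) n),
        (∀ n (x : strictSignedSelmerLayer W κ ℚ_[p] (-1) n),
          ((γL n x : strictSignedSelmerLayer W κ ℚ_[p] (-1) n) : W.subgroupH1 p (κ.layerSubgroup n)) =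
            W.conjH1 p (κ.layerSubgroup n) γ (x : W.subgroupH1 p (κ.layerSubgroup n))) →
      ∀ (ι : ∀ n, strictSignedSelmerLayer W κ ℚ_[p] (-1) n →+ strictSignedSelmerLayer W κ ℚ_[p] (-1) (n + 1)),
        (∀ n (x : strictSignedSelmerLayer W κ ℚ_[p] (-1) n),
          ((ι n x : strictSignedSelmerLayer W κ ℚ_[p] (-1) (n + 1)) : W.subgroupH1 p (κ.layerSubgroup (n + 1))) =
            W.resOfLe p (κ.layerSubgroup_antitone n.le_succ)
              (x : W.subgroupH1 p (κ.layerSubgroup n))) →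
      ∃ (Dn : ∀ n, AddSubgroup (strictSignedSelmerLayer W κ ℚ_[p] (-1) n))
        (pair : ∀ n, strictSignedSelmerLayer W κ ℚ_[p] (-1) n →+ strictSignedSelmerLayer W κ ℚ_[p] (-1) n →+ AddCircle (1 : ℚ)) (m : ℕ),
      (∀ n (t : strictSignedSelmerLayer W κ ℚ_[p] (-1) (n + 1)), ∃ t' : strictSignedSelmerLayer W κ ℚ_[p] (-1) n,
        r n t' = ∑ i ∈ Finset.range p,
          ((conjStrictSignedSelmerInfty W κ ℚ_[p] (-1) γ) ^ (p ^ n * i)) (r (n + 1) t) ∧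
        ∀ y : strictSignedSelmerLayer W κ ℚ_[p] (-1) n, pair n y t' = pair (n + 1) (ι n y) t) ∧
      (∀ n, ∀ d ∈ Dn n, ∃ d' ∈ Dn n, p • d' = d) ∧
      (∀ n, ∀ d ∈ Dn n, γL n d ∈ Dn n) ∧
      (∀ n, m ≤ n → (Dn (n + 1)).map (r (n + 1)) ≤ (Dn n).map (r n)) ∧
      (∀ n (t : strictSignedSelmerLayer W κ ℚ_[p] (-1) n),
        (∀ y : strictSignedSelmerLayer W κ ℚ_[p] (-1) n, pair n y t = 0) → t ∈ Dn n) ∧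
      (∀ n, ∀ t ∈ Dn n, ∀ y : strictSignedSelmerLayer W κ ℚ_[p] (-1) n, pair n y t = 0) ∧
      (∀ n (g : strictSignedSelmerLayer W κ ℚ_[p] (-1) n →+ AddCircle (1 : ℚ)), (∀ d ∈ Dn n, g d = 0) →
        ∃ c : strictSignedSelmerLayer W κ ℚ_[p] (-1) n, ∀ y : strictSignedSelmerLayer W κ ℚ_[p] (-1) n, g y = pair n y c) ∧
      (∀ n (y t : strictSignedSelmerLayer W κ ℚ_[p] (-1) n), pair n (γL n y) (γL n t) = pair n y t)) :
    NoFiniteSubmoduleSigned :=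
  noFiniteSubmoduleSigned_of_signs (noFiniteSubmodulePlus_of_casselsTateLayerInputs hplus)
    (noFiniteSubmoduleMinus_of_casselsTateLayerInputs hminus)

end Summit.BirchSwinnertonDyer.BirchSwinnertonDyer.Theorems

end
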